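import Literature.NumberTheory.ConnesConsani2021.SpectralCertFrame
import Mathlib.Analysis.SpecialFunctions.Integrals.Basic
import HarnessLib

/-!
# An `L¹` panel frame for the archimedean kernel estimate `∫_{[−log 2, log 2]} |τ_c − ϖ| ≤ ε₁`

RH-FREE corpus literature (label, line 1): elementary real-analysis bookkeeping (a change of variables
`v = log ρ` and a sum over panels); nothing in this file mentions `ζ`, the critical strip or RH, and
nothing here bears on the truth of RH.  bears_on (cell rh-crit, corpus C1): apex input (C) — route
«ConnesConsaniSemilocal» item K3 `WindowSpectralBound` (stmt 19306), whose remaining literature input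
is the (E-a) `L¹` enclosure of `CC2021_section6_enclosures` (isolated as ONE real inequality in
`ArchKernelL1Frame.lean`: `section6_enclosures_iff_L1`).

STATUS (cell rulings, 2026-08-26): director-rh 07:13:15Z — the in-kernel (E-a) certificate is NOT
STAFFED this wave; cc-lead R93 (3) — this is the 0-kit ANALYTIC FRAME (Tier 1) only.  The theorem
below turns the one inequality into FINITELY MANY per-panel sup-bounds (the future Tier-2 obligations,
to be decided in the kernel by interval arithmetic in the style of `EpsSlopeKernel.lean` /
`SpectralCertCheck.lean`), a tail bound and a slope enclosure; it proves none of them.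

## What is here (all PROVED; 0 definitions, 0 named facts, no numerics)

* `SpectralCert.conj_frameKernel`, `frameKernel_im`, `frameKernel_neg`, `norm_frameKernel_le` — the
  certificate kernel `τ_c = Σ_{|n|≤N} c_{|n|}κ_{n/2}` (`SpectralCert.frameKernel`) is real, even and
  bounded by `|b−a|⁻¹ Σ_{|n|≤N} |c_{|n|}|`;
* **`setIntegral_Icc_norm_sub_le_of_panels` — THE FRAME**: for a continuous, real, even kernel `τ`
  with `‖τ‖ ≤ B`, a target of the printed shape `v ↦ S(e^{|v|})/(2e)` (CC's `ϖ = (Qε)(e^{|v|})/(2ε′(1₊))`,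
  `S` = the series (97) of Prop. 5.3, `e = ε′(1₊)` of Lemma 5.4), a slope enclosure `e, ẽ ∈ [e⁻, e⁺]`
  (`e⁻ > 0`), a uniform tail/truncation bound `|S − P| ≤ T` on `[1,2]` and per-panel bounds
  `|2ẽ·τ(log ρ) − P(ρ)| ≤ M_k` on `ρ ∈ [a_k, a_{k+1}]` (`1 = a₀ ≤ a₁ ≤ … ≤ a_m = 2`):
  `∫_{[−log 2, log 2]} ‖τ(v) − S(e^{|v|})/(2e)‖ dv ≤ e⁻⁻¹·(Σ_k M_k (a_{k+1}−a_k)/a_k + 2(e⁺−e⁻)B + T)`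
  (evenness; `v = log ρ`, `dv = dρ/ρ ≤ dρ/a_k` on the `k`-th panel).

Source: A. Connes, C. Consani, *Weil positivity and trace formula, the archimedean place*, Selecta
Math. (N.S.) 27 (2021) 77 = arXiv:2006.13771 [bib `ConnesConsani2021`], §6.3–6.4 p. 24 (the kernel
`ϖ`, Fact 6.1 "`‖τ − ϖ‖₁ ≤ ε₁` … (computer calculation)", Lemma 6.3 `‖𝐊_I − T‖ ≤ ‖τ − ϖ‖₁`); §5
eq. (101) p. 33 ("passing to the additive scale").

WHAT THIS FILE IS NOT: a certificate, an enclosure of `ϖ`, a discharge of (E-a), or anything about RH.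
-/

noncomputable section

open Real Set MeasureTheory Filter Topology

namespace Literature.NumberTheory.ConnesConsani2021

namespace SpectralCert

/-! ## The certificate kernel `τ_c` is real, even and bounded -/

variable {a b : ℝ}

/-- `‖κ_α(v)‖ = |b − a|⁻¹`. [cite: ConnesConsani2021, §6.4 display (opkf1) p. 24] -/
theorem norm_expKernel (a b α v : ℝ) : ‖expKernel a b α v‖ = |(b - a)⁻¹| := by
  rw [expKernel, norm_mul, Complex.norm_real, Complex.norm_exp_ofReal_mul_I, mul_one, Real.norm_eq_abs]

/-- `κ_α(−v) = κ_{−α}(v)`. [cite: ConnesConsani2021, §6.4 display (opkf1) p. 24] -/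
theorem expKernel_neg_arg (a b α v : ℝ) : expKernel a b α (-v) = expKernel a b (-α) v := by
  simp only [expKernel]
  congr 3
  push_cast
  ring

/-- `conj τ_c = τ_c`: the symmetric sum `Σ_{|n| ≤ N} c_{|n|} κ_{n/2}` is real (conjugation flips
`n ↦ −n`). [cite: ConnesConsani2021, §6.4 display (opkf1) p. 24] -/
theorem conj_frameKernel (a b : ℝ) (N : ℕ) (c : ℕ → ℝ) (v : ℝ) :
    (starRingEnd ℂ) (frameKernel a b N c v) = frameKernel a b N c v := by
  unfold frameKernel
  rw [map_sum]
  simp only [map_mul, Complex.conj_ofReal, conj_expKernel]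
  -- reindex `n ↦ −n` over the symmetric window
  refine Finset.sum_nbij' (fun n ↦ -n) (fun n ↦ -n) ?_ ?_ ?_ ?_ ?_
  · intro n hn
    simp only [Finset.mem_Icc] at hn ⊢
    omega
  · intro n hn
    simp only [Finset.mem_Icc] at hn ⊢
    omega
  · intro n _; simp
  · intro n _; simp
  · intro n _
    simp only [Int.natAbs_neg, Int.cast_neg, neg_div]

/-- `τ_c(v)` is real: `im τ_c(v) = 0`. [cite: ConnesConsani2021, §6.4 display (opkf1) p. 24] -/
theorem frameKernel_im (a b : ℝ) (N : ℕ) (c : ℕ → ℝ) (v : ℝ) : (frameKernel a b N c v).im = 0 := by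
  have h := conj_frameKernel a b N c v
  exact Complex.conj_eq_iff_im.mp h

/-- `τ_c` is even. [cite: ConnesConsani2021, §6.4 display (opkf1) p. 24] -/
theorem frameKernel_neg (a b : ℝ) (N : ℕ) (c : ℕ → ℝ) (v : ℝ) :
    frameKernel a b N c (-v) = frameKernel a b N c v := by
  unfold frameKernel
  simp only [expKernel_neg_arg]
  refine Finset.sum_nbij' (fun n ↦ -n) (fun n ↦ -n) ?_ ?_ ?_ ?_ ?_
  · intro n hn
    simp only [Finset.mem_Icc] at hn ⊢
    omega
  · intro n hn
    simp only [Finset.mem_Icc] at hn ⊢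
    omega
  · intro n _; simp
  · intro n _; simp
  · intro n _
    simp only [Int.natAbs_neg, Int.cast_neg, neg_div]

/-- `‖τ_c(v)‖ ≤ |b − a|⁻¹ Σ_{|n| ≤ N} |c_{|n|}|`. [cite: ConnesConsani2021, §6.4 display (opkf1) p. 24] -/
theorem norm_frameKernel_le (a b : ℝ) (N : ℕ) (c : ℕ → ℝ) (v : ℝ) :
    ‖frameKernel a b N c v‖ ≤ |(b - a)⁻¹| * ∑ n ∈ Finset.Icc (-(N : ℤ)) N, |c n.natAbs| := by
  unfold frameKernel
  refine (norm_sum_le _ _).trans ?_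
  rw [Finset.mul_sum]
  refine Finset.sum_le_sum fun n _ ↦ ?_
  rw [norm_mul, Complex.norm_real, norm_expKernel, Real.norm_eq_abs, mul_comm]

/-! ### Derivative and Lipschitz bounds for `τ_c` (Tier-2 support, appended 2026-08-26)

For a per-panel certificate that evaluates `τ_c(log ρ)` at finitely many points, the variation of
`τ_c` across a panel is controlled by the explicit derivative bound below. -/

/-- `κ_α′(v) = κ_α(v) · (2πα/L) i`. [cite: ConnesConsani2021, §6.4 display (opkf1) p. 24] -/
theorem hasDerivAt_expKernel (a b α v : ℝ) :
    HasDerivAt (expKernel a b α) (expKernel a b α v * ((((2 * π * α / (b - a) : ℝ) : ℂ)) * Complex.I)) v := by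
  have h1 : HasDerivAt (fun v : ℝ ↦ ((2 * π * α * v / (b - a) : ℝ) : ℂ) * Complex.I)
      ((((2 * π * α / (b - a) : ℝ) : ℂ)) * Complex.I) v := by
    have h0 : HasDerivAt (fun v : ℝ ↦ 2 * π * α * v / (b - a)) (2 * π * α / (b - a)) v := by
      have := ((hasDerivAt_id v).const_mul (2 * π * α)).div_const (b - a)
      simpa using this
    exact (h0.ofReal_comp).mul_const Complex.I
  have h2 : HasDerivAt (fun v : ℝ ↦ (((b - a)⁻¹ : ℝ) : ℂ) *
      Complex.exp (((2 * π * α * v / (b - a) : ℝ) : ℂ) * Complex.I))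
      ((((b - a)⁻¹ : ℝ) : ℂ) * (Complex.exp (((2 * π * α * v / (b - a) : ℝ) : ℂ) * Complex.I)
        * ((((2 * π * α / (b - a) : ℝ) : ℂ)) * Complex.I))) v :=
    (h1.cexp).const_mul _
  have e : expKernel a b α = fun v : ℝ ↦ (((b - a)⁻¹ : ℝ) : ℂ) *
      Complex.exp (((2 * π * α * v / (b - a) : ℝ) : ℂ) * Complex.I) := rfl
  rw [e]
  exact h2.congr_deriv (by ring)

/-- `‖κ_α′(v)‖ = |L⁻¹| · (2π|α|/|L|)`. [cite: ConnesConsani2021, §6.4 display (opkf1) p. 24] -/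
theorem norm_deriv_expKernel (a b α v : ℝ) :
    ‖expKernel a b α v * ((((2 * π * α / (b - a) : ℝ) : ℂ)) * Complex.I)‖
      = |(b - a)⁻¹| * (2 * π * |α| / |b - a|) := by
  rw [norm_mul, norm_mul, Complex.norm_I, mul_one, norm_expKernel, Complex.norm_real, Real.norm_eq_abs,
    abs_div, abs_mul, abs_of_pos Real.two_pi_pos]

/-- `τ_c′(v) = Σ_{|n| ≤ N} c_{|n|} κ_{n/2}′(v)`. [cite: ConnesConsani2021, §6.4 display (opkf1) p. 24] -/
theorem hasDerivAt_frameKernel (a b : ℝ) (N : ℕ) (c : ℕ → ℝ) (v : ℝ) :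
    HasDerivAt (frameKernel a b N c)
      (∑ n ∈ Finset.Icc (-(N : ℤ)) N, ((c n.natAbs : ℝ) : ℂ) *
        (expKernel a b ((n : ℝ) / 2) v * ((((2 * π * ((n : ℝ) / 2) / (b - a) : ℝ) : ℂ)) * Complex.I))) v := by
  have h : HasDerivAt (fun v ↦ ∑ n ∈ Finset.Icc (-(N : ℤ)) N,
      ((c n.natAbs : ℝ) : ℂ) * expKernel a b ((n : ℝ) / 2) v)
      (∑ n ∈ Finset.Icc (-(N : ℤ)) N, ((c n.natAbs : ℝ) : ℂ) *
        (expKernel a b ((n : ℝ) / 2) v * ((((2 * π * ((n : ℝ) / 2) / (b - a) : ℝ) : ℂ)) * Complex.I))) v :=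
    HasDerivAt.fun_sum fun n _ ↦ (hasDerivAt_expKernel a b _ v).const_mul _
  exact h

/-- **Explicit derivative bound for `τ_c`**: `‖τ_c′(v)‖ ≤ |L⁻¹|·Σ_{|n| ≤ N} |c_{|n|}|·(π|n|/|L|)`.
[cite: ConnesConsani2021, §6.4 display (opkf1) p. 24] -/
theorem norm_deriv_frameKernel_le (a b : ℝ) (N : ℕ) (c : ℕ → ℝ) (v : ℝ) :
    ‖deriv (frameKernel a b N c) v‖
      ≤ |(b - a)⁻¹| * ∑ n ∈ Finset.Icc (-(N : ℤ)) N, |c n.natAbs| * (π * |(n : ℝ)| / |b - a|) := by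
  rw [(hasDerivAt_frameKernel a b N c v).deriv]
  refine (norm_sum_le _ _).trans ?_
  rw [Finset.mul_sum]
  refine Finset.sum_le_sum fun n _ ↦ ?_
  rw [norm_mul, Complex.norm_real, Real.norm_eq_abs, norm_deriv_expKernel, abs_div, abs_two]
  apply le_of_eq
  ring

/-- **Lipschitz bound for `τ_c`**: `‖τ_c(v) − τ_c(w)‖ ≤ D·|v − w|` with the explicit constant
`D = |L⁻¹|·Σ_{|n| ≤ N} |c_{|n|}|·(π|n|/|L|)` (mean value inequality).  For a panel certificate:
`|τ_c(log ρ) − τ_c(log ρ₀)| ≤ D·|log ρ − log ρ₀| ≤ D·|ρ − ρ₀|` on `[1,2]`.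
[cite: ConnesConsani2021, §6.4 display (opkf1) p. 24] -/
theorem norm_frameKernel_sub_le (a b : ℝ) (N : ℕ) (c : ℕ → ℝ) (v w : ℝ) :
    ‖frameKernel a b N c v - frameKernel a b N c w‖
      ≤ (|(b - a)⁻¹| * ∑ n ∈ Finset.Icc (-(N : ℤ)) N, |c n.natAbs| * (π * |(n : ℝ)| / |b - a|))
        * |v - w| := by
  have h := Convex.norm_image_sub_le_of_norm_deriv_le (f := frameKernel a b N c) (s := Set.univ)
    (fun x _ ↦ (hasDerivAt_frameKernel a b N c x).differentiableAt)
    (fun x _ ↦ norm_deriv_frameKernel_le a b N c x) convex_univ (mem_univ w) (mem_univ v)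
  rwa [Real.norm_eq_abs] at h

end SpectralCert

/-! ## The panel frame -/

/-- Along a monotone chain `a 0 ≤ a 1 ≤ … ≤ a m`, every `a k` (`k ≤ m`) lies between the ends. [folklore] -/
private theorem chain_mem_Icc {a : ℕ → ℝ} {m : ℕ} (hmono : ∀ k < m, a k ≤ a (k + 1)) {k : ℕ}
    (hk : k ≤ m) : a 0 ≤ a k ∧ a k ≤ a m := by
  constructor
  · induction k with
    | zero => exact le_rfl
    | succ j ih => exact (ih (by omega)).trans (hmono j (by omega))
  · induction hk with
    | refl => exact le_rfl
    | step hle ih => exact ih (fun i hi ↦ hmono i (by omega)) |>.trans (hmono _ (by omega))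

/-- RH-FREE. **The `L¹` panel frame.**  Let `τ : ℝ → ℂ` be continuous, real (`im τ = 0`), even and
bounded by `B`; let the target have the printed shape `v ↦ S(e^{|v|})/(2e)` (`ϖ = (Qε)(e^{|v|})/(2ε′(1₊))`,
§6.3 p. 24) with `S` continuous on `[1,2]`, a slope enclosure `e, ẽ ∈ [e⁻, e⁺]`, `0 < e⁻`, a uniform
truncation bound `|S − P| ≤ T` on `[1,2]` and per-panel bounds `|2ẽ·Re τ(log ρ) − P(ρ)| ≤ M_k` for
`ρ ∈ [a_k, a_{k+1}]`, `1 = a₀ ≤ … ≤ a_m = 2`.  Then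
`∫_{[−log 2, log 2]} ‖τ(v) − S(e^{|v|})/(2e)‖ dv ≤ e⁻⁻¹ (Σ_{k<m} M_k (a_{k+1} − a_k)/a_k + 2(e⁺−e⁻)B + T)`.
(Evenness halves the window; `v = log ρ`, `dv = dρ/ρ`, `1/ρ ≤ 1/a_k` on the `k`-th panel;
`|2eτ − S| ≤ |2ẽτ − P| + 2|e−ẽ||τ| + |P − S|`.)  The per-panel bounds, `T` and `[e⁻, e⁺]` are the
obligations of a (deferred) kernel certificate.
[cite: ConnesConsani2021, §6.4 Fact 6.1 + Lemma 6.3 p. 24; §6.3 p. 24; §5 eq. (101) p. 33] -/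
theorem setIntegral_Icc_norm_sub_le_of_panels
    {τ : ℝ → ℂ} {S P : ℝ → ℝ} {e elo ehi et T B : ℝ} {m : ℕ} {a M : ℕ → ℝ}
    (hτc : Continuous τ) (hτim : ∀ v, (τ v).im = 0) (hτev : ∀ v, τ (-v) = τ v)
    (hτB : ∀ v, ‖τ v‖ ≤ B) (hSc : ContinuousOn S (Icc 1 2))
    (helo : 0 < elo) (he : elo ≤ e ∧ e ≤ ehi) (het : elo ≤ et ∧ et ≤ ehi)
    (hT : ∀ ρ ∈ Icc (1 : ℝ) 2, |S ρ - P ρ| ≤ T)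
    (ha0 : a 0 = 1) (ham : a m = 2) (hmono : ∀ k < m, a k ≤ a (k + 1))
    (hM : ∀ k < m, ∀ ρ ∈ Icc (a k) (a (k + 1)), |2 * et * (τ (Real.log ρ)).re - P ρ| ≤ M k) :
    ∫ v in Icc (-Real.log 2) (Real.log 2), ‖τ v - (((S (Real.exp |v|) / (2 * e) : ℝ)) : ℂ)‖
      ≤ (1 / elo) * (∑ k ∈ Finset.range m, M k * ((a (k + 1) - a k) / a k)
          + (2 * (ehi - elo) * B + T)) := by
  -- Notation: the integrand `g`, the constants
  set L : ℝ := Real.log 2 with hL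
  have hL0 : 0 < L := Real.log_pos one_lt_two
  have he0 : 0 < e := lt_of_lt_of_le helo he.1
  have hB0 : 0 ≤ B := le_trans (norm_nonneg _) (hτB 0)
  set g : ℝ → ℝ := fun v ↦ ‖τ v - (((S (Real.exp |v|) / (2 * e) : ℝ)) : ℂ)‖ with hg
  -- `g` is even and equals `|Re τ − S(e^{|v|})/(2e)|`
  have hg_even : ∀ v, g (-v) = g v := by
    intro v; simp only [hg, hτev, abs_neg]
  have hg_re : ∀ v, g v = |(τ v).re - S (Real.exp |v|) / (2 * e)| := by
    intro v
    have hτv : τ v - (((S (Real.exp |v|) / (2 * e) : ℝ)) : ℂ)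
        = ((((τ v).re - S (Real.exp |v|) / (2 * e) : ℝ)) : ℂ) := by
      apply Complex.ext <;> simp [hτim v]
    simp only [hg]
    rw [hτv, Complex.norm_real, Real.norm_eq_abs]
  -- continuity of `g` on `[−L, L]` (there `e^{|v|} ∈ [1,2]`)
  have hexp_mem : ∀ v ∈ Icc (-L) L, Real.exp |v| ∈ Icc (1 : ℝ) 2 := by
    intro v hv
    refine ⟨Real.one_le_exp (abs_nonneg v), ?_⟩
    have h1 : |v| ≤ L := abs_le.2 ⟨hv.1, hv.2⟩
    calc Real.exp |v| ≤ Real.exp L := Real.exp_le_exp.2 h1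
      _ = 2 := by rw [hL, Real.exp_log two_pos]
  have hgc : ContinuousOn g (Icc (-L) L) := by
    have h1 : ContinuousOn (fun v ↦ S (Real.exp |v|)) (Icc (-L) L) :=
      hSc.comp (by fun_prop) hexp_mem
    have h2 : ContinuousOn (fun v ↦ τ v - (((S (Real.exp |v|) / (2 * e) : ℝ)) : ℂ)) (Icc (-L) L) :=
      hτc.continuousOn.sub (Complex.continuous_ofReal.comp_continuousOn (h1.div_const _))
    exact h2.norm
  -- Step 1: the set integral is an interval integral, and evenness halves it
  have hgi_l : IntervalIntegrable g volume (-L) 0 :=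
    (hgc.mono (Icc_subset_Icc le_rfl hL0.le)).intervalIntegrable_of_Icc (by linarith)
  have hgi_r : IntervalIntegrable g volume 0 L :=
    (hgc.mono (Icc_subset_Icc (by linarith) le_rfl)).intervalIntegrable_of_Icc hL0.le
  have hstep1 : ∫ v in Icc (-L) L, g v = 2 * ∫ v in (0 : ℝ)..L, g v := by
    rw [integral_Icc_eq_integral_Ioc, ← intervalIntegral.integral_of_le (by linarith),
      ← intervalIntegral.integral_add_adjacent_intervals hgi_l hgi_r]
    have hneg : ∫ v in (-L)..0, g v = ∫ v in (0 : ℝ)..L, g v := by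
      have h1 : ∫ v in (0 : ℝ)..L, g (-v) = ∫ v in (-L)..(-0), g v := intervalIntegral.integral_comp_neg g
      rw [neg_zero] at h1
      rw [← h1]
      exact intervalIntegral.integral_congr fun v _ ↦ hg_even v
    rw [hneg]
    ring
  -- Step 2: change of variables `v = log ρ` on `[0, L] = log '' [1, 2]`
  have hstep2 : ∫ v in (0 : ℝ)..L, g v = ∫ ρ in (1 : ℝ)..2, g (Real.log ρ) * ρ⁻¹ := by
    have hderiv : ∀ x ∈ uIcc (1 : ℝ) 2, HasDerivAt Real.log x⁻¹ x := by
      intro x hx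
      rw [Set.uIcc_of_le one_le_two] at hx
      exact Real.hasDerivAt_log (by linarith [hx.1])
    have hcont : ContinuousOn (fun x : ℝ ↦ x⁻¹) (uIcc (1 : ℝ) 2) := by
      rw [Set.uIcc_of_le one_le_two]
      exact continuousOn_inv₀.mono fun x hx ↦ by simp only [mem_compl_iff, mem_singleton_iff]; linarith [hx.1]
    have himg : Real.log '' uIcc (1 : ℝ) 2 ⊆ Icc (-L) L := by
      rw [Set.uIcc_of_le one_le_two]
      rintro _ ⟨x, hx, rfl⟩
      constructor
      · have := Real.log_nonneg hx.1; linarith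
      · exact Real.log_le_log (by linarith [hx.1]) hx.2
    have h := intervalIntegral.integral_comp_mul_deriv' hderiv hcont (hgc.mono himg)
    rw [Real.log_one, ← hL] at h
    rw [← h]
    rfl
  -- Step 3: the pointwise bound on the `k`-th panel
  set C : ℕ → ℝ := fun k ↦ (M k + 2 * (ehi - elo) * B + T) / (2 * elo) with hC
  have hpanel : ∀ k < m, ∀ ρ ∈ Icc (a k) (a (k + 1)), g (Real.log ρ) ≤ C k := by
    intro k hk ρ hρ
    have hak : 1 ≤ a k := by rw [← ha0]; exact (chain_mem_Icc hmono hk.le).1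
    have hak1 : a (k + 1) ≤ 2 := by rw [← ham]; exact (chain_mem_Icc hmono (by omega)).2
    have hρ1 : 1 ≤ ρ := hak.trans hρ.1
    have hρ2 : ρ ≤ 2 := hρ.2.trans hak1
    have hρ0 : 0 < ρ := by linarith
    have hexp : Real.exp |Real.log ρ| = ρ := by
      rw [abs_of_nonneg (Real.log_nonneg hρ1), Real.exp_log hρ0]
    rw [hg_re, hexp]
    simp only [hC]
    set t := (τ (Real.log ρ)).re with ht
    have htB : |t| ≤ B := (Complex.abs_re_le_norm _).trans (hτB _)
    have h1 := hM k hk ρ hρ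
    have h2 := hT ρ ⟨hρ1, hρ2⟩
    have hMk : 0 ≤ M k := le_trans (abs_nonneg _) h1
    have hT0 : 0 ≤ T := le_trans (abs_nonneg _) h2
    have hδ : 0 ≤ ehi - elo := by linarith [he.1, he.2]
    have h2e : 0 < 2 * e := by linarith
    have h2elo : 0 < 2 * elo := by linarith
    -- `|t − S/(2e)| = |2e t − S| / (2e)`
    have hkey : |t - S ρ / (2 * e)| = |2 * e * t - S ρ| / (2 * e) := by
      rw [show t - S ρ / (2 * e) = (2 * e * t - S ρ) / (2 * e) by field_simp]
      rw [abs_div, abs_of_pos h2e]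
    rw [hkey, div_le_div_iff₀ h2e h2elo]
    -- `|2et − S| ≤ |2ẽt − P| + 2|e − ẽ||t| + |P − S|`
    have htri : |2 * e * t - S ρ| ≤ |2 * et * t - P ρ| + 2 * |e - et| * |t| + |S ρ - P ρ| := by
      have e1 : 2 * e * t - S ρ = (2 * et * t - P ρ) + 2 * (e - et) * t + (P ρ - S ρ) := by ring
      rw [e1]
      refine (abs_add_three _ _ _).trans ?_
      rw [abs_mul, abs_mul, abs_two, abs_sub_comm (P ρ) (S ρ)]
    have heet : |e - et| ≤ ehi - elo :=
      abs_sub_le_iff.2 ⟨by linarith [he.2, het.1], by linarith [he.1, het.2]⟩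
    have hmid : 2 * |e - et| * |t| ≤ 2 * (ehi - elo) * B :=
      mul_le_mul (mul_le_mul_of_nonneg_left heet zero_le_two) htB (abs_nonneg _)
        (mul_nonneg zero_le_two hδ)
    have hsum0 : 0 ≤ M k + 2 * (ehi - elo) * B + T :=
      add_nonneg (add_nonneg hMk (mul_nonneg (mul_nonneg zero_le_two hδ) hB0)) hT0
    calc |2 * e * t - S ρ| * (2 * elo)
        ≤ (M k + 2 * (ehi - elo) * B + T) * (2 * elo) := by
          refine mul_le_mul_of_nonneg_right ?_ h2elo.le
          linarith [htri, h1, h2, hmid]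
      _ ≤ (M k + 2 * (ehi - elo) * B + T) * (2 * e) :=
          mul_le_mul_of_nonneg_left (by linarith [he.1]) hsum0
  -- Step 4: split `[1,2]` along the panels and bound each piece
  have hGc : ContinuousOn (fun ρ : ℝ ↦ g (Real.log ρ) * ρ⁻¹) (Icc 1 2) := by
    have hlog : ContinuousOn Real.log (Icc (1 : ℝ) 2) :=
      Real.continuousOn_log.mono fun x hx ↦ by simp only [mem_compl_iff, mem_singleton_iff]; linarith [hx.1]
    have himg : MapsTo Real.log (Icc (1 : ℝ) 2) (Icc (-L) L) := by
      intro x hx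
      constructor
      · have := Real.log_nonneg hx.1; linarith
      · exact Real.log_le_log (by linarith [hx.1]) hx.2
    refine (hgc.comp hlog himg).mul ?_
    exact continuousOn_inv₀.mono fun x hx ↦ by simp only [mem_compl_iff, mem_singleton_iff]; linarith [hx.1]
  have hGi : ∀ k < m, IntervalIntegrable (fun ρ : ℝ ↦ g (Real.log ρ) * ρ⁻¹) volume (a k) (a (k + 1)) := by
    intro k hk
    have hak : 1 ≤ a k := by rw [← ha0]; exact (chain_mem_Icc hmono hk.le).1
    have hak1 : a (k + 1) ≤ 2 := by rw [← ham]; exact (chain_mem_Icc hmono (by omega)).2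
    exact (hGc.mono (Icc_subset_Icc hak hak1)).intervalIntegrable_of_Icc (hmono k hk)
  have hsplit : ∫ ρ in (1 : ℝ)..2, g (Real.log ρ) * ρ⁻¹
      = ∑ k ∈ Finset.range m, ∫ ρ in a k..a (k + 1), g (Real.log ρ) * ρ⁻¹ := by
    rw [← ha0, ← ham]
    exact (intervalIntegral.sum_integral_adjacent_intervals hGi).symm
  have hpiece : ∀ k ∈ Finset.range m,
      ∫ ρ in a k..a (k + 1), g (Real.log ρ) * ρ⁻¹ ≤ C k * ((a (k + 1) - a k) / a k) := by
    intro k hk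
    rw [Finset.mem_range] at hk
    have hak : 1 ≤ a k := by rw [← ha0]; exact (chain_mem_Icc hmono hk.le).1
    have hle : a k ≤ a (k + 1) := hmono k hk
    have hCk : 0 ≤ C k :=
      le_trans (norm_nonneg _) (hpanel k hk (a k) (left_mem_Icc.2 hle))
    calc ∫ ρ in a k..a (k + 1), g (Real.log ρ) * ρ⁻¹
        ≤ ∫ ρ in a k..a (k + 1), C k * (a k)⁻¹ := by
          refine intervalIntegral.integral_mono_on hle (hGi k hk) intervalIntegrable_const fun ρ hρ ↦ ?_
          have hρ0 : 0 < ρ := by linarith [hρ.1]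
          have hg0 : 0 ≤ g (Real.log ρ) := norm_nonneg _
          exact mul_le_mul (hpanel k hk ρ hρ) (by
            rw [inv_le_inv₀ hρ0 (by linarith)]; exact hρ.1) (by positivity) hCk
      _ = C k * ((a (k + 1) - a k) / a k) := by
          rw [intervalIntegral.integral_const, smul_eq_mul]
          field_simp
  -- Step 5: assemble
  have hsum_le : ∑ k ∈ Finset.range m, ∫ ρ in a k..a (k + 1), g (Real.log ρ) * ρ⁻¹
      ≤ ∑ k ∈ Finset.range m, C k * ((a (k + 1) - a k) / a k) := Finset.sum_le_sum hpiece
  -- `Σ C_k Δ_k/a_k = (2e⁻)⁻¹ (Σ M_k Δ_k/a_k + (2δB + T) Σ Δ_k/a_k)` and `Σ Δ_k/a_k ≤ Σ Δ_k = 1`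
  have hΔ_nonneg : ∀ k ∈ Finset.range m, 0 ≤ (a (k + 1) - a k) / a k := by
    intro k hk
    rw [Finset.mem_range] at hk
    have hak : 1 ≤ a k := by rw [← ha0]; exact (chain_mem_Icc hmono hk.le).1
    exact div_nonneg (by linarith [hmono k hk]) (by linarith)
  have hΔ_sum : ∑ k ∈ Finset.range m, (a (k + 1) - a k) / a k ≤ 1 := by
    have h1 : ∑ k ∈ Finset.range m, (a (k + 1) - a k) / a k ≤ ∑ k ∈ Finset.range m, (a (k + 1) - a k) := by
      refine Finset.sum_le_sum fun k hk ↦ ?_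
      rw [Finset.mem_range] at hk
      have hak : 1 ≤ a k := by rw [← ha0]; exact (chain_mem_Icc hmono hk.le).1
      exact div_le_self (by linarith [hmono k hk]) hak
    rw [Finset.sum_range_sub, ham, ha0] at h1
    linarith
  have hTδ : 0 ≤ 2 * (ehi - elo) * B + T := by
    have hT0 : 0 ≤ T := le_trans (abs_nonneg _) (hT 1 ⟨le_rfl, one_le_two⟩)
    have hδ : 0 ≤ ehi - elo := by linarith [he.1, he.2]
    exact add_nonneg (mul_nonneg (mul_nonneg zero_le_two hδ) hB0) hT0
  have hCsum : ∑ k ∈ Finset.range m, C k * ((a (k + 1) - a k) / a k)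
      ≤ (1 / (2 * elo)) * (∑ k ∈ Finset.range m, M k * ((a (k + 1) - a k) / a k)
          + (2 * (ehi - elo) * B + T)) := by
    have hexp : ∑ k ∈ Finset.range m, C k * ((a (k + 1) - a k) / a k)
        = (1 / (2 * elo)) * (∑ k ∈ Finset.range m, M k * ((a (k + 1) - a k) / a k)
            + (2 * (ehi - elo) * B + T) * ∑ k ∈ Finset.range m, (a (k + 1) - a k) / a k) := by
      have hpt : ∀ k ∈ Finset.range m, C k * ((a (k + 1) - a k) / a k)
          = (1 / (2 * elo)) * (M k * ((a (k + 1) - a k) / a k)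
              + (2 * (ehi - elo) * B + T) * ((a (k + 1) - a k) / a k)) := by
        intro k _
        simp only [hC]
        field_simp
        ring
      rw [Finset.sum_congr rfl hpt, ← Finset.mul_sum, Finset.sum_add_distrib, ← Finset.mul_sum]
    rw [hexp]
    refine mul_le_mul_of_nonneg_left ?_ (by positivity)
    have := mul_le_of_le_one_right hTδ hΔ_sum
    linarith
  -- put everything together
  calc ∫ v in Icc (-L) L, g v
      = 2 * ∫ ρ in (1 : ℝ)..2, g (Real.log ρ) * ρ⁻¹ := by rw [hstep1, hstep2]
    _ = 2 * ∑ k ∈ Finset.range m, ∫ ρ in a k..a (k + 1), g (Real.log ρ) * ρ⁻¹ := by rw [hsplit]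
    _ ≤ 2 * ((1 / (2 * elo)) * (∑ k ∈ Finset.range m, M k * ((a (k + 1) - a k) / a k)
          + (2 * (ehi - elo) * B + T))) := by
        exact mul_le_mul_of_nonneg_left (hsum_le.trans hCsum) zero_le_two
    _ = (1 / elo) * (∑ k ∈ Finset.range m, M k * ((a (k + 1) - a k) / a k)
          + (2 * (ehi - elo) * B + T)) := by
        field_simp

end Literature.NumberTheory.ConnesConsani2021

end
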